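import Mathlib.Data.Real.Basic
import Mathlib.Tactic.Linarith
import HarnessLib

/-!
# QUANT lane R8, front "FAR beyond trees", layer one — THE HAIRED EAR AT THE OBSERVER, VIa: the box inequalities of the coverage analysis (part A)

builds on p205010 (kernel theorem, internal audit signed; external expert review pending)

Support file (`--supports stmt-CriticalPhenomena-4575`), seat `prim-quant-p1` (gen 27); memo
`run/shared/lean/prim/quant/prim-quant-p1-g27/FOR-LEAD-HAIR.md` §3.  Pure real arithmetic; standard axioms; no sorries; no definitions.

The decision tree of `…EarHairArithMaster` (which of the four certificates of `…EarHairArith` applies) rests on sixteen polynomial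
inequalities in the three pair weights `p, r, s ∈ [0,1]` (some with one or two side conditions).  Each is proved here by an explicit
HANDELMAN CERTIFICATE — a representation as a nonnegative combination of products of the box atoms `p, 1−p, r, 1−r, s, 1−s` (and the
side conditions) — found offline by linear programming (seat folder `num/possat3.py`, exact rational re-verification) and replayed by
`linarith` over the monomials.  Notation (expanded in the statements): `W = (1−p)(1−r)`, `Q = 1 − W`, `Φ = 1 − s + sW`, `Λ = W + 1 − s`,
`κ = Q(1 − rs) + W(1 − r)`, `Ā₁ = W(1 − pr) − pκ`, `Ā₂ = W(1 − pr) − 2pκ`, `λ′ = (1−s)Q + sW`.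
[this work]; certificates in the style of [cite: KozmaNitzan2024, Conjecture 3 (p. 15)]'s layer-one row served by this chain.
-/

namespace Summit.CriticalPhenomena.PercolationContinuityZ3.Theorems

namespace Quant

namespace EarHair

/-- Box inequality `I1` of the coverage analysis (memo §3), by a Handelman certificate (9 products). [this work] -/
theorem box_I1 {p r s : ℝ} (hp0 : 0 ≤ p) (hp1 : p ≤ 1) (hr0 : 0 ≤ r) (hr1 : r ≤ 1) (hs0 : 0 ≤ s) (hs1 : s ≤ 1)
    (hH : 0 ≤ (2 * ((1 - p) * (1 - r)) - 1)) :
    0 ≤ ((1 - p * r) * ((1 - (1 - p) * (1 - r)) ^ 2 * (1 - s) + ((1 - p) * (1 - r)) * (1 - (1 - p) * (1 - r) * (1 - s))) - p * ((1 - (1 - p)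
      * (1 - r)) * (1 - r * s) + ((1 - p) * (1 - r)) * (1 - r))) := by
  have hP : 0 ≤ 1 - p := by linarith
  have hR : 0 ≤ 1 - r := by linarith
  have hS : 0 ≤ 1 - s := by linarith
  linarith [mul_nonneg hP hr0, mul_nonneg (mul_nonneg hp0 hr0) hr0, mul_nonneg (mul_nonneg hp0 hr0) hs0, mul_nonneg (mul_nonneg (mul_nonneg
    hp0 hp0) hp0) hr0, mul_nonneg (mul_nonneg (mul_nonneg hp0 hp0) hr0) hR, mul_nonneg (mul_nonneg (mul_nonneg hp0 hP) hr0) hr0, mul_nonneg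
    (mul_nonneg (mul_nonneg hP hP) hP) hr0, mul_nonneg hs0 hH, mul_nonneg (mul_nonneg (mul_nonneg hp0 hr0) hS) hH]

/-- Box inequality `I2` of the coverage analysis (memo §3), by a Handelman certificate (28 products). [this work] -/
theorem box_I2 {p r s : ℝ} (hp0 : 0 ≤ p) (hp1 : p ≤ 1) (hr0 : 0 ≤ r) (hr1 : r ≤ 1) (hs0 : 0 ≤ s) (hs1 : s ≤ 1)
    :
    0 ≤ (2 * p * (1 - r) * (1 - r * (1 - p)) + (1 - s + s * ((1 - p) * (1 - r))) * ((1 - p) + (p * r) * (1 - s)) - ((1 - p) * (1 - r)) * (1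
      - p * r)) := by
  have hP : 0 ≤ 1 - p := by linarith
  have hR : 0 ≤ 1 - r := by linarith
  have hS : 0 ≤ 1 - s := by linarith
  linarith [mul_nonneg (mul_nonneg hp0 hp0) hR, mul_nonneg (mul_nonneg hp0 hR) hS, mul_nonneg (mul_nonneg hr0 hR) hS, mul_nonneg (mul_nonneg
    hr0 hS) hS, mul_nonneg (mul_nonneg (mul_nonneg hp0 hr0) hS) hS, mul_nonneg (mul_nonneg (mul_nonneg hp0 hR) hR) hR, mul_nonneg
    (mul_nonneg (mul_nonneg hp0 hR) hR) hs0, mul_nonneg (mul_nonneg (mul_nonneg hp0 hs0) hS) hS, mul_nonneg (mul_nonneg (mul_nonneg hP hr0)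
    hr0) hS, mul_nonneg (mul_nonneg (mul_nonneg hr0 hR) hs0) hS, mul_nonneg (mul_nonneg (mul_nonneg hr0 hs0) hS) hS, mul_nonneg (mul_nonneg
    (mul_nonneg (mul_nonneg hp0 hP) hR) hR) hS, mul_nonneg (mul_nonneg (mul_nonneg (mul_nonneg hp0 hr0) hR) hR) hR, mul_nonneg (mul_nonneg
    (mul_nonneg (mul_nonneg hp0 hR) hR) hs0) hs0, mul_nonneg (mul_nonneg (mul_nonneg (mul_nonneg hp0 hR) hs0) hs0) hS, mul_nonneg
    (mul_nonneg (mul_nonneg (mul_nonneg hP hr0) hr0) hR) hS, mul_nonneg (mul_nonneg (mul_nonneg (mul_nonneg (mul_nonneg hp0 hp0) hr0) hR)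
    hs0) hs0, mul_nonneg (mul_nonneg (mul_nonneg (mul_nonneg (mul_nonneg hp0 hr0) hr0) hR) hR) hs0, mul_nonneg (mul_nonneg (mul_nonneg
    (mul_nonneg (mul_nonneg hp0 hr0) hr0) hS) hS) hS, mul_nonneg (mul_nonneg (mul_nonneg (mul_nonneg (mul_nonneg hp0 hr0) hR) hR) hs0) hs0,
    mul_nonneg (mul_nonneg (mul_nonneg (mul_nonneg (mul_nonneg hp0 hr0) hR) hs0) hs0) hS, mul_nonneg (mul_nonneg (mul_nonneg (mul_nonneg
    (mul_nonneg hP hr0) hr0) hr0) hR) hS, mul_nonneg (mul_nonneg (mul_nonneg (mul_nonneg (mul_nonneg hP hr0) hr0) hR) hs0) hS, mul_nonneg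
    (mul_nonneg (mul_nonneg (mul_nonneg (mul_nonneg hP hr0) hr0) hs0) hs0) hS, mul_nonneg (mul_nonneg (mul_nonneg (mul_nonneg (mul_nonneg
    hr0 hr0) hr0) hr0) hS) hS, mul_nonneg (mul_nonneg (mul_nonneg (mul_nonneg (mul_nonneg hr0 hr0) hr0) hs0) hS) hS, mul_nonneg (mul_nonneg
    (mul_nonneg (mul_nonneg (mul_nonneg hr0 hr0) hR) hR) hs0) hS, mul_nonneg (mul_nonneg (mul_nonneg (mul_nonneg (mul_nonneg hr0 hR) hR)
    hs0) hs0) hS]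

/-- Box inequality `I3a` of the coverage analysis (memo §3), by a Handelman certificate (35 products). [this work] -/
theorem box_I3a {p r s : ℝ} (hp0 : 0 ≤ p) (hp1 : p ≤ 1) (hr0 : 0 ≤ r) (hr1 : r ≤ 1) (hs0 : 0 ≤ s) (hs1 : s ≤ 1)
    (hH : 0 ≤ (((1 - p) * (1 - r)) * (1 - p * r) - 2 * p * ((1 - (1 - p) * (1 - r)) * (1 - r * s) + ((1 - p) * (1 - r)) * (1 - r)))) :
    0 ≤ (((1 - s + s * ((1 - p) * (1 - r))) * (2 - p - s * (p * r)) - ((1 - p) * (1 - r)) * (1 - p * r)) - 2 * (p * r) * ((1 - p) * (1 -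
      r))) := by
  have hP : 0 ≤ 1 - p := by linarith
  have hR : 0 ≤ 1 - r := by linarith
  have hS : 0 ≤ 1 - s := by linarith
  linarith [hS, mul_nonneg hr0 hS, mul_nonneg hs0 hS, mul_nonneg (mul_nonneg hR hR) hR, mul_nonneg (mul_nonneg hR hR) hs0, mul_nonneg
    (mul_nonneg (mul_nonneg hp0 hp0) hR) hs0, mul_nonneg (mul_nonneg (mul_nonneg hp0 hp0) hs0) hS, mul_nonneg (mul_nonneg (mul_nonneg hP hP)
    hr0) hS, mul_nonneg (mul_nonneg (mul_nonneg hr0 hr0) hr0) hS, mul_nonneg (mul_nonneg (mul_nonneg hr0 hr0) hS) hS, mul_nonneg (mul_nonneg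
    (mul_nonneg (mul_nonneg hp0 hp0) hr0) hR) hR, mul_nonneg (mul_nonneg (mul_nonneg (mul_nonneg hp0 hp0) hr0) hR) hs0, mul_nonneg
    (mul_nonneg (mul_nonneg (mul_nonneg hp0 hr0) hr0) hR) hS, mul_nonneg (mul_nonneg (mul_nonneg (mul_nonneg hr0 hR) hR) hs0) hs0,
    mul_nonneg (mul_nonneg (mul_nonneg (mul_nonneg hr0 hs0) hS) hS) hS, mul_nonneg (mul_nonneg (mul_nonneg (mul_nonneg hs0 hs0) hs0) hs0)
    hS, mul_nonneg (mul_nonneg (mul_nonneg (mul_nonneg hs0 hs0) hs0) hS) hS, mul_nonneg (mul_nonneg (mul_nonneg (mul_nonneg hs0 hs0) hS) hS)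
    hS, mul_nonneg (mul_nonneg (mul_nonneg (mul_nonneg (mul_nonneg hp0 hp0) hr0) hr0) hr0) hS, mul_nonneg (mul_nonneg (mul_nonneg
    (mul_nonneg (mul_nonneg hp0 hp0) hr0) hr0) hR) hs0, mul_nonneg (mul_nonneg (mul_nonneg (mul_nonneg (mul_nonneg hp0 hp0) hr0) hs0) hS)
    hS, mul_nonneg (mul_nonneg (mul_nonneg (mul_nonneg (mul_nonneg hp0 hp0) hR) hs0) hs0) hs0, mul_nonneg (mul_nonneg (mul_nonneg
    (mul_nonneg (mul_nonneg hp0 hp0) hs0) hs0) hs0) hS, mul_nonneg (mul_nonneg (mul_nonneg (mul_nonneg (mul_nonneg hp0 hp0) hs0) hs0) hS)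
    hS, mul_nonneg (mul_nonneg (mul_nonneg (mul_nonneg (mul_nonneg hp0 hP) hr0) hr0) hr0) hS, mul_nonneg (mul_nonneg (mul_nonneg (mul_nonneg
    (mul_nonneg hp0 hP) hr0) hr0) hs0) hS, mul_nonneg (mul_nonneg (mul_nonneg (mul_nonneg (mul_nonneg hp0 hP) hR) hR) hR) hs0, mul_nonneg
    (mul_nonneg (mul_nonneg (mul_nonneg (mul_nonneg hp0 hr0) hr0) hr0) hs0) hS, mul_nonneg (mul_nonneg (mul_nonneg (mul_nonneg (mul_nonneg
    hP hr0) hr0) hr0) hs0) hS, mul_nonneg (mul_nonneg (mul_nonneg (mul_nonneg (mul_nonneg hr0 hr0) hs0) hs0) hs0) hS, mul_nonneg (mul_nonneg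
    (mul_nonneg (mul_nonneg (mul_nonneg hr0 hr0) hs0) hs0) hS) hS, mul_nonneg (mul_nonneg (mul_nonneg (mul_nonneg (mul_nonneg hR hR) hs0)
    hs0) hs0) hs0, mul_nonneg (mul_nonneg (mul_nonneg (mul_nonneg (mul_nonneg hR hR) hs0) hs0) hs0) hS, mul_nonneg hr0 hH, mul_nonneg hs0
    hH]

/-- Box inequality `I3b` of the coverage analysis (memo §3), by a Handelman certificate (27 products). [this work] -/
theorem box_I3b {p r s : ℝ} (hp0 : 0 ≤ p) (hp1 : p ≤ 1) (hr0 : 0 ≤ r) (hr1 : r ≤ 1) (hs0 : 0 ≤ s) (hs1 : s ≤ 1)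
    :
    0 ≤ (((1 - (1 - p) * (1 - r)) * (1 - r * s) + ((1 - p) * (1 - r)) * (1 - r)) * ((1 - s + s * ((1 - p) * (1 - r))) * (2 - p - s * (p *
      r)) - ((1 - p) * (1 - r)) * (1 - p * r)) - r * ((1 - p) * (1 - r)) * ((1 - p) * (1 - r)) * (1 - p * r)) := by
  have hP : 0 ≤ 1 - p := by linarith
  have hR : 0 ≤ 1 - r := by linarith
  have hS : 0 ≤ 1 - s := by linarith
  linarith [mul_nonneg (mul_nonneg hS hS) hS, mul_nonneg (mul_nonneg (mul_nonneg hp0 hP) hR) hS, mul_nonneg (mul_nonneg (mul_nonneg hP hr0)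
    hR) hS, mul_nonneg (mul_nonneg (mul_nonneg hR hs0) hS) hS, mul_nonneg (mul_nonneg (mul_nonneg (mul_nonneg hp0 hp0) hR) hR) hS,
    mul_nonneg (mul_nonneg (mul_nonneg (mul_nonneg hp0 hP) hr0) hS) hS, mul_nonneg (mul_nonneg (mul_nonneg (mul_nonneg hp0 hr0) hR) hS) hS,
    mul_nonneg (mul_nonneg (mul_nonneg (mul_nonneg hp0 hr0) hS) hS) hS, mul_nonneg (mul_nonneg (mul_nonneg (mul_nonneg hP hP) hR) hR) hR,
    mul_nonneg (mul_nonneg (mul_nonneg (mul_nonneg hP hr0) hr0) hS) hS, mul_nonneg (mul_nonneg (mul_nonneg (mul_nonneg hP hr0) hs0) hS) hS,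
    mul_nonneg (mul_nonneg (mul_nonneg (mul_nonneg hr0 hR) hs0) hS) hS, mul_nonneg (mul_nonneg (mul_nonneg (mul_nonneg hR hR) hs0) hs0) hS,
    mul_nonneg (mul_nonneg (mul_nonneg (mul_nonneg (mul_nonneg hP hP) hR) hR) hR) hs0, mul_nonneg (mul_nonneg (mul_nonneg (mul_nonneg
    (mul_nonneg (mul_nonneg hp0 hP) hP) hr0) hR) hs0) hS, mul_nonneg (mul_nonneg (mul_nonneg (mul_nonneg (mul_nonneg (mul_nonneg hp0 hP)
    hr0) hR) hR) hs0) hS, mul_nonneg (mul_nonneg (mul_nonneg (mul_nonneg (mul_nonneg (mul_nonneg hp0 hP) hr0) hR) hs0) hS) hS, mul_nonneg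
    (mul_nonneg (mul_nonneg (mul_nonneg (mul_nonneg (mul_nonneg hP hP) hr0) hr0) hr0) hS) hS, mul_nonneg (mul_nonneg (mul_nonneg (mul_nonneg
    (mul_nonneg (mul_nonneg hP hP) hr0) hr0) hR) hs0) hS, mul_nonneg (mul_nonneg (mul_nonneg (mul_nonneg (mul_nonneg (mul_nonneg hP hr0) hR)
    hR) hs0) hs0) hS, mul_nonneg (mul_nonneg (mul_nonneg (mul_nonneg (mul_nonneg (mul_nonneg (mul_nonneg hp0 hP) hP) hr0) hr0) hR) hR) hs0,
    mul_nonneg (mul_nonneg (mul_nonneg (mul_nonneg (mul_nonneg (mul_nonneg (mul_nonneg hp0 hP) hr0) hR) hR) hs0) hs0) hS, mul_nonneg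
    (mul_nonneg (mul_nonneg (mul_nonneg (mul_nonneg (mul_nonneg (mul_nonneg hP hP) hr0) hr0) hR) hs0) hs0) hS, mul_nonneg (mul_nonneg
    (mul_nonneg (mul_nonneg (mul_nonneg (mul_nonneg (mul_nonneg hP hr0) hr0) hR) hR) hs0) hs0) hS, mul_nonneg (mul_nonneg (mul_nonneg
    (mul_nonneg (mul_nonneg (mul_nonneg (mul_nonneg (mul_nonneg hp0 hp0) hP) hr0) hr0) hR) hs0) hS) hS, mul_nonneg (mul_nonneg (mul_nonneg
    (mul_nonneg (mul_nonneg (mul_nonneg (mul_nonneg (mul_nonneg (mul_nonneg hp0 hp0) hP) hr0) hr0) hr0) hR) hs0) hs0) hS, mul_nonneg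
    (mul_nonneg (mul_nonneg (mul_nonneg (mul_nonneg (mul_nonneg (mul_nonneg (mul_nonneg (mul_nonneg hP hP) hP) hr0) hr0) hr0) hR) hs0) hs0)
    hS]

/-- Box inequality `I4a` of the coverage analysis (memo §3), by a Handelman certificate (59 products). [this work] -/
theorem box_I4a {p r s : ℝ} (hp0 : 0 ≤ p) (hp1 : p ≤ 1) (hr0 : 0 ≤ r) (hr1 : r ≤ 1) (hs0 : 0 ≤ s) (hs1 : s ≤ 1)
    :
    0 ≤ (2 * ((1 - p) - (1 - s + s * ((1 - p) * (1 - r))) + p * ((1 - (1 - p) * (1 - r)) * (1 - r * s) + ((1 - p) * (1 - r)) * (1 - r))) +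
      ((1 - s + s * ((1 - p) * (1 - r))) * (2 - p - s * (p * r)) - ((1 - p) * (1 - r)) * (1 - p * r))) := by
  have hP : 0 ≤ 1 - p := by linarith
  have hR : 0 ≤ 1 - r := by linarith
  have hS : 0 ≤ 1 - s := by linarith
  linarith [hR, mul_nonneg hP hP, mul_nonneg hP hr0, mul_nonneg hr0 hR, mul_nonneg hS hS, mul_nonneg (mul_nonneg hp0 hp0) hR, mul_nonneg
    (mul_nonneg hp0 hP) hr0, mul_nonneg (mul_nonneg hp0 hR) hs0, mul_nonneg (mul_nonneg hr0 hr0) hR, mul_nonneg (mul_nonneg hR hR) hs0,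
    mul_nonneg (mul_nonneg hR hs0) hs0, mul_nonneg (mul_nonneg hs0 hS) hS, mul_nonneg (mul_nonneg (mul_nonneg hp0 hp0) hP) hP, mul_nonneg
    (mul_nonneg (mul_nonneg hp0 hP) hP) hs0, mul_nonneg (mul_nonneg (mul_nonneg hp0 hr0) hR) hR, mul_nonneg (mul_nonneg (mul_nonneg hP hP)
    hr0) hs0, mul_nonneg (mul_nonneg (mul_nonneg hP hr0) hs0) hS, mul_nonneg (mul_nonneg (mul_nonneg hP hs0) hs0) hS, mul_nonneg (mul_nonneg
    (mul_nonneg hr0 hr0) hS) hS, mul_nonneg (mul_nonneg (mul_nonneg (mul_nonneg hp0 hp0) hp0) hP) hP, mul_nonneg (mul_nonneg (mul_nonneg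
    (mul_nonneg hp0 hp0) hp0) hR) hR, mul_nonneg (mul_nonneg (mul_nonneg (mul_nonneg hp0 hp0) hP) hs0) hs0, mul_nonneg (mul_nonneg
    (mul_nonneg (mul_nonneg hp0 hp0) hR) hs0) hs0, mul_nonneg (mul_nonneg (mul_nonneg (mul_nonneg hp0 hP) hr0) hr0) hs0, mul_nonneg
    (mul_nonneg (mul_nonneg (mul_nonneg hp0 hP) hs0) hS) hS, mul_nonneg (mul_nonneg (mul_nonneg (mul_nonneg hp0 hr0) hr0) hR) hR, mul_nonneg
    (mul_nonneg (mul_nonneg (mul_nonneg hp0 hR) hR) hs0) hs0, mul_nonneg (mul_nonneg (mul_nonneg (mul_nonneg hP hP) hs0) hs0) hs0,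
    mul_nonneg (mul_nonneg (mul_nonneg (mul_nonneg hP hr0) hs0) hs0) hS, mul_nonneg (mul_nonneg (mul_nonneg (mul_nonneg hr0 hr0) hr0) hr0)
    hR, mul_nonneg (mul_nonneg (mul_nonneg (mul_nonneg hr0 hr0) hr0) hR) hR, mul_nonneg (mul_nonneg (mul_nonneg (mul_nonneg hr0 hr0) hR) hR)
    hs0, mul_nonneg (mul_nonneg (mul_nonneg (mul_nonneg hr0 hR) hR) hs0) hs0, mul_nonneg (mul_nonneg (mul_nonneg (mul_nonneg hR hs0) hs0)
    hs0) hS, mul_nonneg (mul_nonneg (mul_nonneg (mul_nonneg hR hs0) hs0) hS) hS, mul_nonneg (mul_nonneg (mul_nonneg (mul_nonneg (mul_nonneg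
    hp0 hp0) hp0) hp0) hp0) hP, mul_nonneg (mul_nonneg (mul_nonneg (mul_nonneg (mul_nonneg hp0 hp0) hp0) hp0) hp0) hR, mul_nonneg
    (mul_nonneg (mul_nonneg (mul_nonneg (mul_nonneg hp0 hp0) hp0) hp0) hP) hP, mul_nonneg (mul_nonneg (mul_nonneg (mul_nonneg (mul_nonneg
    hp0 hp0) hp0) hp0) hr0) hR, mul_nonneg (mul_nonneg (mul_nonneg (mul_nonneg (mul_nonneg hp0 hp0) hp0) hp0) hS) hS, mul_nonneg (mul_nonneg
    (mul_nonneg (mul_nonneg (mul_nonneg hp0 hp0) hp0) hP) hP) hr0, mul_nonneg (mul_nonneg (mul_nonneg (mul_nonneg (mul_nonneg hp0 hp0) hp0)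
    hP) hS) hS, mul_nonneg (mul_nonneg (mul_nonneg (mul_nonneg (mul_nonneg hp0 hp0) hp0) hr0) hr0) hR, mul_nonneg (mul_nonneg (mul_nonneg
    (mul_nonneg (mul_nonneg hp0 hp0) hP) hP) hr0) hr0, mul_nonneg (mul_nonneg (mul_nonneg (mul_nonneg (mul_nonneg hp0 hp0) hr0) hr0) hr0)
    hR, mul_nonneg (mul_nonneg (mul_nonneg (mul_nonneg (mul_nonneg hp0 hp0) hR) hR) hs0) hs0, mul_nonneg (mul_nonneg (mul_nonneg (mul_nonneg
    (mul_nonneg hp0 hp0) hR) hR) hs0) hS, mul_nonneg (mul_nonneg (mul_nonneg (mul_nonneg (mul_nonneg hp0 hP) hP) hr0) hr0) hr0, mul_nonneg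
    (mul_nonneg (mul_nonneg (mul_nonneg (mul_nonneg hp0 hP) hr0) hr0) hr0) hS, mul_nonneg (mul_nonneg (mul_nonneg (mul_nonneg (mul_nonneg
    hp0 hP) hr0) hr0) hs0) hs0, mul_nonneg (mul_nonneg (mul_nonneg (mul_nonneg (mul_nonneg hp0 hP) hR) hR) hR) hS, mul_nonneg (mul_nonneg
    (mul_nonneg (mul_nonneg (mul_nonneg hp0 hr0) hr0) hS) hS) hS, mul_nonneg (mul_nonneg (mul_nonneg (mul_nonneg (mul_nonneg hp0 hr0) hR)
    hs0) hs0) hS, mul_nonneg (mul_nonneg (mul_nonneg (mul_nonneg (mul_nonneg hP hP) hr0) hr0) hr0) hr0, mul_nonneg (mul_nonneg (mul_nonneg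
    (mul_nonneg (mul_nonneg hP hr0) hR) hs0) hs0) hs0, mul_nonneg (mul_nonneg (mul_nonneg (mul_nonneg (mul_nonneg hr0 hr0) hr0) hr0) hS) hS,
    mul_nonneg (mul_nonneg (mul_nonneg (mul_nonneg (mul_nonneg hr0 hr0) hr0) hR) hs0) hs0, mul_nonneg (mul_nonneg (mul_nonneg (mul_nonneg
    (mul_nonneg hr0 hr0) hr0) hs0) hS) hS, mul_nonneg (mul_nonneg (mul_nonneg (mul_nonneg (mul_nonneg hr0 hr0) hR) hs0) hs0) hs0]

/-- Box inequality `I4b` of the coverage analysis (memo §3), by a Handelman certificate (27 products). [this work] -/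
theorem box_I4b {p r s : ℝ} (hp0 : 0 ≤ p) (hp1 : p ≤ 1) (hr0 : 0 ≤ r) (hr1 : r ≤ 1) (hs0 : 0 ≤ s) (hs1 : s ≤ 1)
    :
    0 ≤ (p * ((1 - (1 - p) * (1 - r)) * (1 - r * s) + ((1 - p) * (1 - r)) * (1 - r)) * ((1 - s + s * ((1 - p) * (1 - r))) * (2 - p - s * (p
      * r)) - ((1 - p) * (1 - r)) * (1 - p * r)) + ((1 - p) - (1 - s + s * ((1 - p) * (1 - r))) + p * ((1 - (1 - p) * (1 - r)) * (1 - r * s)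
      + ((1 - p) * (1 - r)) * (1 - r))) * ((1 - p) * (1 - r)) * (1 - p * r)) := by
  have hP : 0 ≤ 1 - p := by linarith
  have hR : 0 ≤ 1 - r := by linarith
  have hS : 0 ≤ 1 - s := by linarith
  linarith [mul_nonneg (mul_nonneg (mul_nonneg (mul_nonneg hp0 hp0) hP) hS) hS, mul_nonneg (mul_nonneg (mul_nonneg (mul_nonneg hp0 hp0) hS)
    hS) hS, mul_nonneg (mul_nonneg (mul_nonneg (mul_nonneg hp0 hP) hP) hR) hR, mul_nonneg (mul_nonneg (mul_nonneg (mul_nonneg hp0 hP) hr0)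
    hS) hS, mul_nonneg (mul_nonneg (mul_nonneg (mul_nonneg hp0 hP) hR) hR) hR, mul_nonneg (mul_nonneg (mul_nonneg (mul_nonneg hp0 hP) hR)
    hs0) hS, mul_nonneg (mul_nonneg (mul_nonneg (mul_nonneg hp0 hR) hR) hs0) hS, mul_nonneg (mul_nonneg (mul_nonneg (mul_nonneg hP hr0) hR)
    hs0) hS, mul_nonneg (mul_nonneg (mul_nonneg (mul_nonneg (mul_nonneg hp0 hp0) hP) hr0) hR) hS, mul_nonneg (mul_nonneg (mul_nonneg
    (mul_nonneg (mul_nonneg hp0 hp0) hR) hs0) hS) hS, mul_nonneg (mul_nonneg (mul_nonneg (mul_nonneg (mul_nonneg hp0 hr0) hR) hs0) hS) hS,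
    mul_nonneg (mul_nonneg (mul_nonneg (mul_nonneg (mul_nonneg hp0 hR) hR) hs0) hs0) hS, mul_nonneg (mul_nonneg (mul_nonneg (mul_nonneg
    (mul_nonneg (mul_nonneg hp0 hp0) hP) hr0) hR) hR) hS, mul_nonneg (mul_nonneg (mul_nonneg (mul_nonneg (mul_nonneg (mul_nonneg hp0 hP) hP)
    hR) hR) hs0) hs0, mul_nonneg (mul_nonneg (mul_nonneg (mul_nonneg (mul_nonneg (mul_nonneg hP hP) hP) hr0) hR) hs0) hs0, mul_nonneg
    (mul_nonneg (mul_nonneg (mul_nonneg (mul_nonneg (mul_nonneg (mul_nonneg hp0 hp0) hP) hP) hr0) hR) hR) hs0, mul_nonneg (mul_nonneg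
    (mul_nonneg (mul_nonneg (mul_nonneg (mul_nonneg (mul_nonneg hp0 hp0) hP) hP) hr0) hR) hs0) hS, mul_nonneg (mul_nonneg (mul_nonneg
    (mul_nonneg (mul_nonneg (mul_nonneg (mul_nonneg hp0 hp0) hP) hr0) hR) hs0) hS) hS, mul_nonneg (mul_nonneg (mul_nonneg (mul_nonneg
    (mul_nonneg (mul_nonneg (mul_nonneg hp0 hP) hP) hr0) hr0) hr0) hS) hS, mul_nonneg (mul_nonneg (mul_nonneg (mul_nonneg (mul_nonneg
    (mul_nonneg (mul_nonneg hp0 hP) hP) hr0) hR) hR) hs0) hs0, mul_nonneg (mul_nonneg (mul_nonneg (mul_nonneg (mul_nonneg (mul_nonneg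
    (mul_nonneg hp0 hP) hr0) hR) hR) hs0) hs0) hS, mul_nonneg (mul_nonneg (mul_nonneg (mul_nonneg (mul_nonneg (mul_nonneg (mul_nonneg hp0
    hP) hR) hR) hR) hs0) hs0) hs0, mul_nonneg (mul_nonneg (mul_nonneg (mul_nonneg (mul_nonneg (mul_nonneg (mul_nonneg (mul_nonneg hp0 hP)
    hr0) hr0) hR) hR) hs0) hs0) hS, mul_nonneg (mul_nonneg (mul_nonneg (mul_nonneg (mul_nonneg (mul_nonneg (mul_nonneg (mul_nonneg
    (mul_nonneg hp0 hp0) hp0) hP) hr0) hr0) hR) hs0) hS) hS, mul_nonneg (mul_nonneg (mul_nonneg (mul_nonneg (mul_nonneg (mul_nonneg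
    (mul_nonneg (mul_nonneg (mul_nonneg hp0 hP) hP) hP) hr0) hR) hR) hs0) hs0) hs0, mul_nonneg (mul_nonneg (mul_nonneg (mul_nonneg
    (mul_nonneg (mul_nonneg (mul_nonneg (mul_nonneg (mul_nonneg (mul_nonneg hp0 hp0) hp0) hP) hr0) hR) hR) hR) hs0) hs0) hS, mul_nonneg
    (mul_nonneg (mul_nonneg (mul_nonneg (mul_nonneg (mul_nonneg (mul_nonneg (mul_nonneg (mul_nonneg (mul_nonneg hp0 hP) hP) hP) hr0) hr0)
    hr0) hR) hs0) hs0) hS]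

/-- Box inequality `I7a` of the coverage analysis (memo §3), by a Handelman certificate (4 products). [this work] -/
theorem box_I7a {p r s : ℝ} (_hp0 : 0 ≤ p) (hp1 : p ≤ 1) (_hr0 : 0 ≤ r) (hr1 : r ≤ 1) (hs0 : 0 ≤ s) (hs1 : s ≤ 1)
    :
    0 ≤ ((1 - s + s * ((1 - p) * (1 - r))) * ((1 - p) * (1 - r) + (1 - s)) - ((1 - p) * (1 - r)) * (1 - s)) := by
  have hP : 0 ≤ 1 - p := by linarith
  have hR : 0 ≤ 1 - r := by linarith
  have hS : 0 ≤ 1 - s := by linarith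
  linarith [mul_nonneg hS hS, mul_nonneg (mul_nonneg (mul_nonneg (mul_nonneg hP hP) hR) hR) hs0, mul_nonneg (mul_nonneg (mul_nonneg
    (mul_nonneg hP hR) hs0) hs0) hS, mul_nonneg (mul_nonneg (mul_nonneg (mul_nonneg hP hR) hs0) hS) hS]


end EarHair

end Quant

end Summit.CriticalPhenomena.PercolationContinuityZ3.Theorems
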